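import Literature.Analysis.FluidPDE.ReynoldsDefectMeasureCompactness
import Literature.Analysis.FunctionSpaces.TorusTrigPoly
import HarnessLib

/-!
# Existence of Reynolds defect measures (DiPerna–Majda) on the flat torus

Discharge of the named fact `Literature.Analysis.FluidPDE.Torus.exists_isReynoldsDefectOf_subseq`:
if `u_n : T^d → ℝ^d` are `L²` fields with `∫ |u_n|² ≤ C` converging weakly in `L²` to `v ∈ L²`
(pairings with smooth fields), then along a subsequence `u_{ψ n} ⊗ u_{ψ n} dx ⇀* v ⊗ v dx + R`
with `R ⪰ 0` a positive semidefinite matrix-valued finite Borel measure (DiPerna–Majda 1987,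
Thm. 1; Majda–Bertozzi 2002, §11.1; De Lellis–Székelyhidi 2012, §2.2,
`R = w*-lim (u_n - v) ⊗ (u_n - v) dx ≥ 0`). Proof: (1) the weak convergence extends from smooth
to all `L²` test fields (uniform bound, density of Fourier truncations,
`Torus.tendsto_eLpNorm_fourierTruncate_sub`); (2) for `a_n := u_n - v` the densities
`g_{ij} = ((a_n)ᵢ + (a_n)ⱼ)²` have `∫ g ≤ 8C + 8∫|v|²`, so the finite measures `g dx` have a common
weakly convergent subsequence (`exists_subseq_forall_tendsto_finiteMeasure_of_mass_le`) with
symmetric limits `μ_{ij}`; (3) polarization `aᵢaⱼ = ½g_{ij} - ⅛g_{ii} - ⅛g_{jj}` defines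
`R i j := ½μ_{ij} - ⅛μ_{ii} - ⅛μ_{jj}` with `∫ φ (a_n)ᵢ(a_n)ⱼ → ∫ φ dR_{ij}`, and the cross terms
`∫ φ (u_n)ᵢ vⱼ → ∫ φ vᵢ vⱼ` by (1); (4) `∑ ξᵢξⱼ ∫ φ dR_{ij} = lim ∫ φ ⟨a_n, ξ⟩² ≥ 0` for `φ ≥ 0`
and `signedMeasure_nonneg_of_forall_integral_nonneg` give `R ⪰ 0`. No new definitions.

## References

* R. J. DiPerna, A. J. Majda, Comm. Math. Phys. 108 (1987) 667–689, §1, Thm. 1, (1.11)–(1.13).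
* A. J. Majda, A. L. Bertozzi, *Vorticity and Incompressible Flow*, CUP 2002, §11.1.
* C. De Lellis, L. Székelyhidi Jr., Bull. AMS 49 (2012), §2.2.
-/

open MeasureTheory Filter Set
open _root_.Topology _root_.TopologicalSpace
open scoped InnerProductSpace ENNReal NNReal BoundedContinuousFunction

noncomputable section

namespace Literature.Analysis.FluidPDE

namespace Torus

open FunctionSpaces.Torus

variable {d : Type*} [Fintype d]

section L2

variable {α : Type*} [MeasurableSpace α] {μ : Measure α}
  {F : Type*} [NormedAddCommGroup F] [InnerProductSpace ℝ F]

/-- The pairing `x ↦ ⟪f x, g x⟫` of two `L²` fields is integrable. [folklore] -/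
theorem integrable_inner_of_memLp_two' {f g : α → F} (hf : MemLp f 2 μ) (hg : MemLp g 2 μ) :
    Integrable (fun x => ⟪f x, g x⟫_ℝ) μ :=
  (hf.norm.integrable_mul hg.norm).mono' (hf.1.inner hg.1)
    (ae_of_all _ fun x => by
      simpa only [Real.norm_eq_abs, Pi.mul_apply] using abs_real_inner_le_norm (f x) (g x))

/-- Cauchy–Schwarz for the `L²` pairing: `|∫ ⟪f, g⟫| ≤ ‖f‖_{L²} ‖g‖_{L²}`. [folklore] -/
theorem abs_integral_inner_le_eLpNorm_mul' {f g : α → F} (hf : MemLp f 2 μ) (hg : MemLp g 2 μ) :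
    |∫ x, ⟪f x, g x⟫_ℝ ∂μ| ≤ (eLpNorm f 2 μ).toReal * (eLpNorm g 2 μ).toReal := by
  have e : ∫ x, ⟪f x, g x⟫_ℝ ∂μ = ⟪hf.toLp f, hg.toLp g⟫_ℝ := by
    rw [L2.inner_def]
    refine integral_congr_ae ?_
    filter_upwards [hf.coeFn_toLp, hg.coeFn_toLp] with x hfx hgx
    rw [hfx, hgx]
  rw [e, ← Lp.norm_toLp f hf, ← Lp.norm_toLp g hg]
  exact abs_real_inner_le_norm _ _

/-- `‖w‖_{L²} ≤ √E` when `∫ ‖w‖² ≤ E`. [folklore] -/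
theorem toReal_eLpNorm_le_sqrt_of_integral_sq_le {w : α → F} (hw : MemLp w 2 μ) {E : ℝ}
    (hE : ∫ x, ‖w x‖ ^ 2 ∂μ ≤ E) : (eLpNorm w 2 μ).toReal ≤ Real.sqrt E := by
  have hsq : ∫ x, ‖w x‖ ^ 2 ∂μ = ((eLpNorm w 2 μ).toReal) ^ 2 := by
    rw [← Lp.norm_toLp w hw, ← real_inner_self_eq_norm_sq (hw.toLp w), L2.inner_def]
    refine integral_congr_ae ?_
    filter_upwards [hw.coeFn_toLp] with x hx
    rw [hx, real_inner_self_eq_norm_sq]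
  rw [hsq] at hE
  calc (eLpNorm w 2 μ).toReal = Real.sqrt (((eLpNorm w 2 μ).toReal) ^ 2) :=
        (Real.sqrt_sq ENNReal.toReal_nonneg).symm
    _ ≤ Real.sqrt E := Real.sqrt_le_sqrt hE

end L2

/-- **Weak `L²` convergence tested with smooth fields extends to `L²` test fields** under a
uniform `L²` bound: if `∫ |u_n|² ≤ C`, `v ∈ L²` and `∫ ⟪w, u_n⟫ → ∫ ⟪w, v⟫` for every smooth `w`,
then `∫ ⟪h, u_n⟫ → ∫ ⟪h, v⟫` for every `h ∈ L²(T^d; ℝ^d)` (approximate `h` in `L²` by its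
Fourier truncations, which are smooth; `ε/3` argument). [folklore] -/
theorem tendsto_integral_inner_of_memLp {u : ℕ → UnitAddTorus d → EuclideanSpace ℝ d}
    {v : UnitAddTorus d → EuclideanSpace ℝ d} {C : ℝ} (hu : ∀ n, MemLp (u n) 2 volume)
    (hC : ∀ n, ∫ x, ‖u n x‖ ^ 2 ≤ C) (hv : MemLp v 2 volume)
    (hweak : ∀ w : UnitAddTorus d → EuclideanSpace ℝ d, IsSmooth w →
      Tendsto (fun n => ∫ x, ⟪w x, u n x⟫_ℝ) atTop (𝓝 (∫ x, ⟪w x, v x⟫_ℝ)))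
    {h : UnitAddTorus d → EuclideanSpace ℝ d} (hh : MemLp h 2 volume) :
    Tendsto (fun n => ∫ x, ⟪h x, u n x⟫_ℝ) atTop (𝓝 (∫ x, ⟪h x, v x⟫_ℝ)) := by
  classical
  rw [Metric.tendsto_atTop]
  intro ε hε
  set A : ℝ := Real.sqrt (max C 0) with hA
  set B : ℝ := (eLpNorm v 2 volume).toReal with hB
  have hA0 : 0 ≤ A := Real.sqrt_nonneg _
  have hB0 : 0 ≤ B := ENNReal.toReal_nonneg
  set δ : ℝ := ε / (3 * (A + B + 1)) with hδ
  have hδ0 : 0 < δ := by positivity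
  -- a smooth `L²`-approximation of `h`
  obtain ⟨N₀, hN₀⟩ : ∃ N₀, eLpNorm (fourierTruncate N₀ h - h) 2 volume < ENNReal.ofReal δ :=
    ((tendsto_eLpNorm_fourierTruncate_sub hh).eventually
      (gt_mem_nhds (ENNReal.ofReal_pos.2 hδ0))).exists
  set w := fourierTruncate N₀ h with hw_def
  have hw : IsSmooth w := isSmooth_fourierTruncate N₀ h
  have hwm : MemLp w 2 volume := hw.memLp 2
  have hhw : MemLp (h - w) 2 volume := hh.sub hwm
  have hhwδ : (eLpNorm (h - w) 2 volume).toReal ≤ δ := by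
    rw [eLpNorm_sub_comm]
    exact ENNReal.toReal_le_of_le_ofReal hδ0.le hN₀.le
  obtain ⟨N₁, hN₁⟩ := (Metric.tendsto_atTop.1 (hweak w hw)) (ε / 3) (by positivity)
  refine ⟨N₁, fun n hn => ?_⟩
  -- splitting `h = (h - w) + w`
  have esplit : ∀ {b : UnitAddTorus d → EuclideanSpace ℝ d}, MemLp b 2 volume →
      ∫ x, ⟪h x, b x⟫_ℝ = (∫ x, ⟪(h - w) x, b x⟫_ℝ) + ∫ x, ⟪w x, b x⟫_ℝ := by
    intro b hb
    rw [← integral_add (integrable_inner_of_memLp_two' hhw hb)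
      (integrable_inner_of_memLp_two' hwm hb)]
    refine integral_congr_ae (ae_of_all _ fun x => ?_)
    simp only [Pi.sub_apply, inner_sub_left]
    ring
  have b1 : |∫ x, ⟪(h - w) x, u n x⟫_ℝ| ≤ δ * A :=
    (abs_integral_inner_le_eLpNorm_mul' hhw (hu n)).trans (mul_le_mul hhwδ
      (toReal_eLpNorm_le_sqrt_of_integral_sq_le (hu n) ((hC n).trans (le_max_left _ _)))
      ENNReal.toReal_nonneg hδ0.le)
  have b2 : |∫ x, ⟪(h - w) x, v x⟫_ℝ| ≤ δ * B :=
    (abs_integral_inner_le_eLpNorm_mul' hhw hv).trans (mul_le_mul_of_nonneg_right hhwδ hB0)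
  have b3 : |(∫ x, ⟪w x, u n x⟫_ℝ) - ∫ x, ⟪w x, v x⟫_ℝ| < ε / 3 := by
    have := hN₁ n hn
    rwa [Real.dist_eq] at this
  have hδAB : δ * A + δ * B ≤ ε / 3 := by
    have h1 : δ * (A + B + 1) = ε / 3 := by
      rw [hδ]; field_simp
    nlinarith
  rw [Real.dist_eq, esplit (hu n), esplit hv]
  calc |(∫ x, ⟪(h - w) x, u n x⟫_ℝ) + (∫ x, ⟪w x, u n x⟫_ℝ) -
        ((∫ x, ⟪(h - w) x, v x⟫_ℝ) + ∫ x, ⟪w x, v x⟫_ℝ)|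
      = |(∫ x, ⟪(h - w) x, u n x⟫_ℝ) + (-(∫ x, ⟪(h - w) x, v x⟫_ℝ)) +
          ((∫ x, ⟪w x, u n x⟫_ℝ) - ∫ x, ⟪w x, v x⟫_ℝ)| := by ring_nf
    _ ≤ |∫ x, ⟪(h - w) x, u n x⟫_ℝ| + |-(∫ x, ⟪(h - w) x, v x⟫_ℝ)| +
          |(∫ x, ⟪w x, u n x⟫_ℝ) - ∫ x, ⟪w x, v x⟫_ℝ| :=
        (abs_add_le _ _).trans (add_le_add (abs_add_le _ _) le_rfl)
    _ < ε := by rw [abs_neg]; linarith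

/-- Components of `L²` fields: `x ↦ a x i + a x j` is in `L²`. [folklore] -/
theorem memLp_two_apply_add_apply {a : UnitAddTorus d → EuclideanSpace ℝ d} (ha : MemLp a 2 volume)
    (i j : d) : MemLp (fun x => a x i + a x j) 2 volume :=
  (memLp_two_apply ha i).add (memLp_two_apply ha j)

/-- Pointwise bound `(aᵢ + aⱼ)² ≤ 4 |a|²`. [folklore] -/
theorem sq_apply_add_apply_le (a : EuclideanSpace ℝ d) (i j : d) :
    (a i + a j) ^ 2 ≤ 4 * ‖a‖ ^ 2 := by
  have hi : |a i| ≤ ‖a‖ := by simpa using PiLp.norm_apply_le a i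
  have hj : |a j| ≤ ‖a‖ := by simpa using PiLp.norm_apply_le a j
  have h1 : |a i + a j| ≤ 2 * ‖a‖ := (abs_add_le _ _).trans (by linarith)
  nlinarith [abs_nonneg (a i + a j), sq_abs (a i + a j)]

/-- The test field `x ↦ (φ x vⱼ(x)) eᵢ` built from a bounded continuous `φ` and an `L²` field
`v` is in `L²`. [folklore] -/
theorem memLp_smul_single [DecidableEq d] (φ : UnitAddTorus d →ᵇ ℝ)
    {v : UnitAddTorus d → EuclideanSpace ℝ d} (hv : MemLp v 2 volume) (i j : d) :
    MemLp (fun x => (φ x * v x j) • EuclideanSpace.single i (1 : ℝ)) 2 volume := by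
  refine MemLp.of_le_mul (c := ‖φ‖) hv ?_ (ae_of_all _ fun x => ?_)
  · have h1 : AEStronglyMeasurable (fun x => v x j) volume :=
      (EuclideanSpace.proj j).continuous.comp_aestronglyMeasurable hv.1
    exact (φ.continuous.aestronglyMeasurable.mul h1).smul_const _
  · rw [norm_smul, PiLp.norm_single, norm_one, mul_one, norm_mul]
    exact mul_le_mul (φ.norm_coe_le_norm x) (by simpa using PiLp.norm_apply_le (v x) j)
      (norm_nonneg _) (norm_nonneg _)

/-- The pairing of the test field `(φ vⱼ) eᵢ` with `b` is `φ vⱼ bᵢ`. [folklore] -/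
theorem inner_smul_single_left [DecidableEq d] (c : ℝ) (i : d) (b : EuclideanSpace ℝ d) :
    ⟪c • EuclideanSpace.single i (1 : ℝ), b⟫_ℝ = c * b i := by
  rw [real_inner_smul_left, EuclideanSpace.inner_single_left]
  simp

/-- Bounded continuous functions are integrable against any (finite) signed measure.
[folklore] -/
theorem signedMeasure_integrable_boundedContinuous {Ω : Type*} [MeasurableSpace Ω]
    [TopologicalSpace Ω] [OpensMeasurableSpace Ω] (s : SignedMeasure Ω) (f : Ω →ᵇ ℝ) :
    s.Integrable f := by
  haveI := MatrixMeasure.isFiniteMeasure_variation s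
  exact BoundedContinuousFunction.integrable _ f

/-- **Existence of Reynolds defect measures (DiPerna–Majda 1987, Thm. 1, on `T^d`).** Discharge
of the named fact `Torus.exists_isReynoldsDefectOf_subseq`: every `L²`-bounded sequence of
velocity fields on the flat torus converging weakly in `L²` has a subsequence with a positive
semidefinite matrix-valued Reynolds defect measure, `u_{ψ n} ⊗ u_{ψ n} dx ⇀* v ⊗ v dx + R`.
See the module docstring for the proof. [cite: DiPernaMajda1987, §1 Thm. 1] -/
theorem exists_isReynoldsDefectOf_subseq_holds (d : Type*) [Fintype d] :
    exists_isReynoldsDefectOf_subseq d := by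
  classical
  intro u v C hu hC hv hweak
  -- the defects `a n := u n - v` and the nonnegative densities `g (i, j) n = ((a n)ᵢ + (a n)ⱼ)²`
  set a : ℕ → UnitAddTorus d → EuclideanSpace ℝ d := fun n x => u n x - v x with ha_def
  have ha : ∀ n, MemLp (a n) 2 volume := fun n => (hu n).sub hv
  set g : d × d → ℕ → UnitAddTorus d → ℝ := fun p n x => (a n x p.1 + a n x p.2) ^ 2 with hg_def
  have hg0 : ∀ p n x, 0 ≤ g p n x := fun p n x => sq_nonneg _
  have hgi : ∀ p n, Integrable (g p n) volume := fun p n =>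
    (memLp_two_apply_add_apply (ha n) p.1 p.2).integrable_sq
  -- uniform bound `∫ g ≤ M`
  set M : ℝ := 8 * C + 8 * ∫ x, ‖v x‖ ^ 2 with hM_def
  have hv2 : Integrable (fun x => ‖v x‖ ^ 2) volume := hv.integrable_norm_pow two_ne_zero
  have hu2 : ∀ n, Integrable (fun x => ‖u n x‖ ^ 2) volume := fun n =>
    (hu n).integrable_norm_pow two_ne_zero
  have hgM : ∀ p n, ∫ x, g p n x ≤ M := by
    intro p n
    have hpt : ∀ x, g p n x ≤ 8 * ‖u n x‖ ^ 2 + 8 * ‖v x‖ ^ 2 := by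
      intro x
      have h1 := sq_apply_add_apply_le (a n x) p.1 p.2
      have h2 : ‖a n x‖ ≤ ‖u n x‖ + ‖v x‖ := norm_sub_le _ _
      have h3a : ‖a n x‖ ^ 2 ≤ (‖u n x‖ + ‖v x‖) ^ 2 := pow_le_pow_left₀ (norm_nonneg _) h2 2
      have h3 : ‖a n x‖ ^ 2 ≤ 2 * ‖u n x‖ ^ 2 + 2 * ‖v x‖ ^ 2 := by
        nlinarith [h3a, sq_nonneg (‖u n x‖ - ‖v x‖)]
      have h4 : g p n x = (a n x p.1 + a n x p.2) ^ 2 := rfl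
      linarith
    calc ∫ x, g p n x ≤ ∫ x, (8 * ‖u n x‖ ^ 2 + 8 * ‖v x‖ ^ 2) :=
          integral_mono (hgi p n) (((hu2 n).const_mul 8).add (hv2.const_mul 8)) hpt
      _ = (8 * ∫ x, ‖u n x‖ ^ 2) + 8 * ∫ x, ‖v x‖ ^ 2 := by
          rw [integral_add ((hu2 n).const_mul 8) (hv2.const_mul 8), integral_const_mul,
            integral_const_mul]
      _ ≤ M := by rw [hM_def]; linarith [hC n]
  -- the finite measures `g dx` and a common weakly convergent subsequence
  choose μs hμs_mass hμs_int using fun p n =>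
    exists_finiteMeasure_integral_eq_mul (volume : Measure (UnitAddTorus d)) (hgi p n) (hg0 p n)
      (hgM p n)
  obtain ⟨ψ, hψ, hlim⟩ := exists_subseq_forall_tendsto_finiteMeasure_of_mass_le μs hμs_mass
  choose μ hμ using hlim
  have hL : ∀ p (f : UnitAddTorus d →ᵇ ℝ), Tendsto (fun n => ∫ x, f x * g p (ψ n) x) atTop
      (𝓝 (∫ x, f x ∂(μ p : Measure (UnitAddTorus d)))) := by
    intro p f
    have h := (FiniteMeasure.tendsto_iff_forall_integral_tendsto.1 (hμ p)) f
    simp only [hμs_int] at h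
    exact h
  -- symmetry of the limits
  have hsym : ∀ i j, μ (i, j) = μ (j, i) := by
    intro i j
    have hseq : ∀ n, μs (i, j) n = μs (j, i) n := by
      intro n
      apply FiniteMeasure.toMeasure_injective
      refine ext_of_forall_integral_eq_of_IsFiniteMeasure fun f => ?_
      rw [hμs_int, hμs_int]
      refine integral_congr_ae (ae_of_all _ fun x => ?_)
      show f x * (a n x i + a n x j) ^ 2 = f x * (a n x j + a n x i) ^ 2
      rw [add_comm]
    exact tendsto_nhds_unique (hμ (i, j)) ((hμ (j, i)).congr fun n => by rw [hseq (ψ n)])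
  -- the matrix measure `R i j := ½ μ_{ij} - ⅛ μ_{ii} - ⅛ μ_{jj}`
  set S : d × d → SignedMeasure (UnitAddTorus d) := fun p =>
    ((μ p : FiniteMeasure (UnitAddTorus d)) : Measure (UnitAddTorus d)).toSignedMeasure with hS_def
  set R : MatrixMeasure d (UnitAddTorus d) := Matrix.of fun i j =>
    (2⁻¹ : ℝ) • S (i, j) - ((8⁻¹ : ℝ) • S (i, i) + (8⁻¹ : ℝ) • S (j, j)) with hR_def
  have hInt : ∀ (s : SignedMeasure (UnitAddTorus d)) (f : UnitAddTorus d →ᵇ ℝ), s.Integrable f :=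
    fun s f => signedMeasure_integrable_boundedContinuous s f
  -- integrals against `R i j`
  have hRint : ∀ (f : UnitAddTorus d →ᵇ ℝ) (i j : d), ∫ᵛ x, f x ∂<•(R i j) =
      2⁻¹ * (∫ x, f x ∂(μ (i, j) : Measure (UnitAddTorus d))) -
        (8⁻¹ * (∫ x, f x ∂(μ (i, i) : Measure (UnitAddTorus d))) +
          8⁻¹ * ∫ x, f x ∂(μ (j, j) : Measure (UnitAddTorus d))) := by
    intro f i j
    simp only [hR_def, Matrix.of_apply]
    rw [VectorMeasure.integral_sub_vectorMeasure (hInt _ f) (hInt _ f),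
      VectorMeasure.integral_add_vectorMeasure (hInt _ f) (hInt _ f),
      VectorMeasure.integral_smul_vectorMeasure, VectorMeasure.integral_smul_vectorMeasure,
      VectorMeasure.integral_smul_vectorMeasure]
    simp only [hS_def, VectorMeasure.integral_toSignedMeasure, smul_eq_mul]
  -- `∫ f (a n)ᵢ (a n)ⱼ → ∫ f d(R i j)` along `ψ` (polarization)
  have hRlim : ∀ (f : UnitAddTorus d →ᵇ ℝ) (i j : d),
      Tendsto (fun n => ∫ x, f x * (a (ψ n) x i * a (ψ n) x j)) atTop
        (𝓝 (∫ᵛ x, f x ∂<•(R i j))) := by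
    intro f i j
    have hfi : ∀ p n, Integrable (fun x => f x * g p n x) volume := fun p n =>
      (hgi p n).bdd_mul f.continuous.aestronglyMeasurable (ae_of_all _ (f.norm_coe_le_norm))
    rw [hRint]
    have h := ((hL (i, j) f).const_mul 2⁻¹).sub
      (((hL (i, i) f).const_mul 8⁻¹).add ((hL (j, j) f).const_mul 8⁻¹))
    refine h.congr fun n => ?_
    have e : ∫ x, f x * (a (ψ n) x i * a (ψ n) x j) = ∫ x, (2⁻¹ * (f x * g (i, j) (ψ n) x) -
        (8⁻¹ * (f x * g (i, i) (ψ n) x) + 8⁻¹ * (f x * g (j, j) (ψ n) x))) := by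
      refine integral_congr_ae (ae_of_all _ fun x => ?_)
      show f x * (a (ψ n) x i * a (ψ n) x j) = 2⁻¹ * (f x * (a (ψ n) x i + a (ψ n) x j) ^ 2) -
        (8⁻¹ * (f x * (a (ψ n) x i + a (ψ n) x i) ^ 2) + 8⁻¹ * (f x * (a (ψ n) x j + a (ψ n) x j) ^ 2))
      ring
    rw [e, integral_sub (g := fun x => 8⁻¹ * (f x * g (i, i) (ψ n) x) + 8⁻¹ * (f x * g (j, j) (ψ n) x))
        ((hfi _ _).const_mul _) (((hfi _ _).const_mul _).add ((hfi _ _).const_mul _)),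
      integral_add ((hfi _ _).const_mul _) ((hfi _ _).const_mul _), integral_const_mul,
      integral_const_mul, integral_const_mul]
  refine ⟨ψ, hψ, R, fun A => ?_, fun φ hφ i j => ?_⟩
  · -- `R` is positive semidefinite
    refine Matrix.PosSemidef.of_dotProduct_mulVec_nonneg ?_ fun ξ => ?_
    · refine Matrix.IsHermitian.ext fun i j => ?_
      have hRsymm : R j i = R i j := by
        simp only [hR_def, Matrix.of_apply, hS_def, hsym j i]
        rw [add_comm]
      simp only [star_trivial, MatrixMeasure.eval_apply, hRsymm]
    · -- the quadratic form is the signed measure `σ = ∑ ξᵢ ξⱼ R i j`, nonnegative on `C(T^d)₊`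
      set σ : SignedMeasure (UnitAddTorus d) := ∑ i, ∑ j, (ξ i * ξ j) • R i j with hσ_def
      have hσA : dotProduct (star ξ) ((R.eval A).mulVec ξ) = σ A := by
        have e1 : σ A = ∑ i, ∑ j, ξ i * ξ j * R i j A := by simp [hσ_def]
        rw [e1]
        simp only [dotProduct, Matrix.mulVec, star_trivial, MatrixMeasure.eval_apply,
          Finset.mul_sum]
        refine Finset.sum_congr rfl fun i _ => Finset.sum_congr rfl fun j _ => ?_
        ring
      rw [hσA]
      refine signedMeasure_nonneg_of_forall_integral_nonneg (fun f hf => ?_) A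
      have e2 : ∫ᵛ x, f x ∂<•σ = ∑ i, ∑ j, ξ i * ξ j * ∫ᵛ x, f x ∂<•(R i j) := by
        rw [hσ_def, VectorMeasure.integral_finsetSum_vectorMeasure fun i _ =>
          VectorMeasure.Integrable.finsetSum_vectorMeasure fun j _ => hInt _ f]
        refine Finset.sum_congr rfl fun i _ => ?_
        rw [VectorMeasure.integral_finsetSum_vectorMeasure fun j _ => hInt _ f]
        refine Finset.sum_congr rfl fun j _ => ?_
        rw [VectorMeasure.integral_smul_vectorMeasure, smul_eq_mul]
      rw [e2]
      have hT := tendsto_finsetSum (Finset.univ : Finset d) fun i _ =>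
        tendsto_finsetSum (Finset.univ : Finset d) fun j _ => (hRlim f i j).const_mul (ξ i * ξ j)
      refine ge_of_tendsto' hT fun n => ?_
      have hfi' : ∀ i j, Integrable (fun x => f x * (a (ψ n) x i * a (ψ n) x j)) volume :=
        fun i j => (integrable_apply_mul_apply_of_memLp_two (ha (ψ n)) i j).bdd_mul
          f.continuous.aestronglyMeasurable (ae_of_all _ (f.norm_coe_le_norm))
      have e4 : ∀ x, f x * (∑ i, ξ i * a (ψ n) x i) ^ 2 =
          ∑ i, ∑ j, ξ i * ξ j * (f x * (a (ψ n) x i * a (ψ n) x j)) := by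
        intro x
        rw [sq, Finset.sum_mul_sum, Finset.mul_sum]
        refine Finset.sum_congr rfl fun i _ => ?_
        rw [Finset.mul_sum]
        refine Finset.sum_congr rfl fun j _ => ?_
        ring
      have e3 : ∫ x, f x * (∑ i, ξ i * a (ψ n) x i) ^ 2 =
          ∑ i, ∑ j, ξ i * ξ j * ∫ x, f x * (a (ψ n) x i * a (ψ n) x j) := by
        rw [integral_congr_ae (ae_of_all _ e4),
          integral_finsetSum _ fun i _ => integrable_finsetSum _ fun j _ => (hfi' i j).const_mul _]
        refine Finset.sum_congr rfl fun i _ => ?_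
        rw [integral_finsetSum _ fun j _ => (hfi' i j).const_mul _]
        refine Finset.sum_congr rfl fun j _ => ?_
        rw [integral_const_mul]
      rw [← e3]
      exact integral_nonneg fun x => mul_nonneg (hf x) (sq_nonneg _)
  · -- the convergence `∫ φ uᵢ uⱼ → ∫ φ vᵢ vⱼ + ∫ φ d(R i j)` along `ψ`
    set f : UnitAddTorus d →ᵇ ℝ := BoundedContinuousFunction.mkOfCompact ⟨φ, hφ⟩ with hf_def
    have hfφ : ∀ x, f x = φ x := fun x => rfl
    -- cross terms: weak convergence tested with the `L²` fields `(φ vⱼ) eᵢ`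
    have hcross : ∀ i j : d, Tendsto (fun n => ∫ x, φ x * (v x j * u (ψ n) x i)) atTop
        (𝓝 (∫ x, φ x * (v x j * v x i))) := by
      intro i j
      have h := (tendsto_integral_inner_of_memLp hu hC hv hweak
        (memLp_smul_single f hv i j)).comp hψ.tendsto_atTop
      simp only [Function.comp_def, inner_smul_single_left, hfφ, mul_assoc] at h
      exact h
    -- integrability of the pieces
    have hI1 : ∀ n, Integrable (fun x => f x * (a n x i * a n x j)) volume := fun n =>
      (integrable_apply_mul_apply_of_memLp_two (ha n) i j).bdd_mul
        f.continuous.aestronglyMeasurable (ae_of_all _ (f.norm_coe_le_norm))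
    have hI2 : ∀ (b c : UnitAddTorus d → EuclideanSpace ℝ d), MemLp b 2 volume → MemLp c 2 volume →
        ∀ k l : d, Integrable (fun x => φ x * (b x k * c x l)) volume := by
      intro b c hb hc k l
      exact ((memLp_two_apply hb k).integrable_mul (memLp_two_apply hc l)).bdd_mul
        f.continuous.aestronglyMeasurable (ae_of_all _ (f.norm_coe_le_norm))
    have hdec : ∀ n, ∫ x, φ x * (u n x i * u n x j) =
        (∫ x, f x * (a n x i * a n x j)) +
          ((∫ x, φ x * (v x j * u n x i)) + ∫ x, φ x * (v x i * u n x j)) -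
            ∫ x, φ x * (v x i * v x j) := by
      intro n
      have e : ∫ x, φ x * (u n x i * u n x j) = ∫ x, (f x * (a n x i * a n x j) +
          (φ x * (v x j * u n x i) + φ x * (v x i * u n x j)) - φ x * (v x i * v x j)) := by
        refine integral_congr_ae (ae_of_all _ fun x => ?_)
        have hax : ∀ k, a n x k = u n x k - v x k := fun k => rfl
        show φ x * (u n x i * u n x j) = f x * (a n x i * a n x j) +
          (φ x * (v x j * u n x i) + φ x * (v x i * u n x j)) - φ x * (v x i * v x j)
        rw [hfφ, hax, hax]
        ring
      rw [e, integral_sub (f := fun x => f x * (a n x i * a n x j) +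
            (φ x * (v x j * u n x i) + φ x * (v x i * u n x j)))
          ((hI1 n).add ((hI2 _ _ hv (hu n) j i).add (hI2 _ _ hv (hu n) i j))) (hI2 _ _ hv hv i j),
        integral_add (g := fun x => φ x * (v x j * u n x i) + φ x * (v x i * u n x j))
          (hI1 n) ((hI2 _ _ hv (hu n) j i).add (hI2 _ _ hv (hu n) i j)),
        integral_add (hI2 _ _ hv (hu n) j i) (hI2 _ _ hv (hu n) i j)]
    have hlim := ((hRlim f i j).add ((hcross i j).add (hcross j i))).sub
      (tendsto_const_nhds (x := ∫ x, φ x * (v x i * v x j)))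
    have hvv : ∫ x, φ x * (v x j * v x i) = ∫ x, φ x * (v x i * v x j) :=
      integral_congr_ae (ae_of_all _ fun x => by
        show φ x * (v x j * v x i) = φ x * (v x i * v x j)
        rw [mul_comm (v x j)])
    rw [hvv] at hlim
    have hval : (∫ᵛ x, f x ∂<•(R i j)) +
        ((∫ x, φ x * (v x i * v x j)) + ∫ x, φ x * (v x i * v x j)) -
          ∫ x, φ x * (v x i * v x j) = (∫ x, φ x * (v x i * v x j)) + ∫ᵛ x, φ x ∂<•(R i j) := by
      show (∫ᵛ x, φ x ∂<•(R i j)) + _ - _ = _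
      ring
    rw [hval] at hlim
    exact hlim.congr fun n => (hdec (ψ n)).symm

end Torus

end Literature.Analysis.FluidPDE

end
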